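/-
Copyright: the b2b-balaban T⁴-continuum CRUX team, row NE7b OWNER lineage `t4-ne7b-p1` (gen 126). Project licence.
-/
import Summits.QuantumFields.BalabanUV.T4Continuum.Spine.NE7b.SupZdCouplingShift
import Summits.QuantumFields.BalabanUV.T4Continuum.Spine.NE7b.SupZdCouplingTransferColumns
import Summits.QuantumFields.BalabanUV.T4Continuum.Spine.NE7b.SupZdCouplingTransferSolvability

/-!
# THE WINDOW STEP: the `H + K` column's PACKAGE at a coupling — block columns with a profile, a bounded solution operator on `ℓ^∞(ℤ^d)`,
# uniqueness of bounded solutions, a two-sided decaying inverse of the coarse matrix — PROPAGATES from `a` to every `a′` with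
# `|a′ − a|` below two EXPLICIT thresholds (`e^{2νd}K_1K_{μ−ν}C_Ψ|a′−a| ≤ 1∕2`, `C_G|a′−a| ≤ 1∕2`), with explicit new constants
# (`C_Ψ′ = 2e^{νd}K_1C_ΨK_{μ−ν}` at rate `ν`, `C_G′ = 2C_G`, `N′ = N + (a′−a)·1`): the inductive step that carries the column along (255)'s
# composed couplings `c_k` without re-proving a single estimate at the new coupling — (262) columns, (263) solvability, (261) uniqueness,
# (259) right inverse, (262) left inverse, assembled (row NE7b, node U5c; (259)∕(261)∕(262)∕(263) BY NAME; [folklore])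

Cell `pub-balaban`, sub-cell `t4`, spine estimate NE7b (`T4WeightBudget.RelWeightBound`; the cell's OWN estimate — NOT PRINTED in
[Bałaban 1983–89], NOT PROVED).  Crux-route work under `Spine/NE7b/` by the row OWNER (`t4-ne7b-p1` gen 126, file (264)) under FREEZE
(0)'s crux-prover clause, on § [NE7bP1-G125-HANDOFF] NEXT (3)(a) (the a-uniformity audit — closing file of the gen-126 answer); NOTHING of
Bałaban's is named as a Lean object, valued or asserted; no `T4Continuum/Support` leaf typed; no `def`, no notation (the package at `a` is ANY
data with the displayed clauses — (213)∕(216)∕(222)∕(237)∕(246) supply it at the road's coupling); zero `sorry`.  Imports (BY NAME): the OWNER's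
(259) `…SupZdCouplingShift` (`coupling_shift_right_inverse`), (262) `…SupZdCouplingTransferColumns` (`transferred_columns`,
`transferred_left_inverse`), (263) `…SupZdCouplingTransferSolvability` (`solution_operator_transfer`, `solvability_of_clm`; through it (261)
`uniqueness_transfer`).

WHY (located).  Gen 126 answered the audit structurally ((258)–(260): `N` shifts by `(a′−a)·1`, `h` and `C` are invariant) and then
constructively ((261)–(263): the inputs of those identities at the shifted coupling come from the reference coupling).  This file states the
result in the form an iteration consumes: ONE theorem, package in ⟹ package out, thresholds and constants explicit, so that crossing (255)'s
window `(a(1 − (n+1)^{−d}), a]` is a finite induction (each step halves nothing but the admissible `|a′−a|` through `C_G ↦ 2C_G` and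
`C_Ψ ↦ 2e^{νd}K_1K_{μ−ν}C_Ψ`, and lowers the profile rate `μ ↦ ν`; the number of steps needed for a window of width `a(n+1)^{−d} ≤ a2^{−d}` is
bounded in terms of the reference constants — recorded, not typed).  With (260) by name, the response kernels and the fluctuation covariance
at `a′` ARE those at `a`, and the next-scale Hessian is `(n+1)^d(N + (a′−a)·1)`.

WHAT IS PROVED ([folklore]; every mesh `n`, ANY `a, a′ : ℝ`, ANY `V`, kernel `|K(p,q)| ≤ εe^{−γ|p−q|₁}`, rates `0 < ν′ < ν < μ`):
**`coupling_window_step`** (THE END): from (P1) columns `Ψ` at `a` with profile `C_Ψ` at rate `μ`, (P2) `G ∈ L(ℓ^∞)` with `‖G‖ ≤ C_G` solving the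
`a`-equation, (P3) uniqueness of bounded solutions at `a`, (P4) a decaying `N` with `T_aN = 1 = NT_a`, and the two thresholds ⟹ `∃ Ψ′ G′`: (P1′)
profile `2e^{νd}K_1C_ΨK_{μ−ν}` at rate `ν` and the `a′`-equations, (P2′) `‖G′f‖ ≤ 2C_G‖f‖` and the `a′`-equation, (P3′) uniqueness at `a′`, (P4′)
`T_{a′}(N + (a′−a)·1) = 1 = (N + (a′−a)·1)T_{a′}` (all sums absolutely convergent); §2 toy.

HONEST (what this is NOT).  Assembly by name; the finite induction across the window and the bookkeeping of its constants are not typed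
here; the package at the road's own coupling is (213)∕(216)∕(222)∕(237) (there the smallness of `K` is against the reference constants ONCE);
scalar skeleton ((A3), NC-NE7b-α UNRULED); nothing of the torus; nothing of the covariant propagators of [B4]–[B6]; nothing of Bałaban's
asserted.  BY-NAME EFFECT ON THE WALL: NONE.  NE7b NOT PRINTED ∕ NOT PROVED; spine PROVED 0∕9; rung (B)+1 — the programme's measures remain
FINITE-torus statements; NOT the mass gap, NOT Clay.  HONEST DEPENDENCY: continuum YM on T⁴ ⇐ BetaPertH ∧ nine spine estimates (0∕9
proved); BetaPertH ⇐ (D1) ∧ (D4) ∧ CAP+tail; G-an2-4 gates asym, D1 and NE2∕3∕4.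
-/

set_option autoImplicit false

noncomputable section

namespace Summit.QuantumFields.BalabanUV.T4Continuum.NE7b.SupZdCouplingWindowStep

open Real Filter Topology
open scoped ENNReal
open Literature.MathematicalPhysics.QuantumFieldTheory.Balaban1983to89
open B6QGQLower276 (X e blk B mem_B sum_B_const)
open SupZdCouplingShift (coupling_shift_right_inverse)
open SupZdCouplingTransferUniqueness (uniqueness_transfer)
open SupZdCouplingTransferColumns (transferred_columns transferred_left_inverse)
open SupZdCouplingTransferSolvability (solution_operator_transfer solvability_of_clm)

variable {d : ℕ}

/-! ## §1. THE END: the package propagates across the coupling window -/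

/-- **HEADLINE — THE WINDOW STEP.**  For every mesh `n`, couplings `a, a′`, potential `V`, kernel `|K(p,q)| ≤ εe^{−γ|p−q|₁}`, rates
`0 < ν′ < ν < μ`, `0 < ν_N`: the package (P1)–(P4) at `a` and the thresholds `e^{νd}K_1·(|a′−a|C_Ψe^{νd}K_{μ−ν}) ≤ 1∕2`, `|a′−a|C_G ≤ 1∕2` give the
package at `a′` — columns `Ψ′` (profile `2e^{νd}K_1C_ΨK_{μ−ν}`, rate `ν`), a solution operator `G′` (`‖G′f‖ ≤ 2C_G‖f‖`), uniqueness of bounded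
solutions, and the two-sided inverse `N + (a′−a)·1` of `T_{a′}(b,c) = (n+1)^{−d}Σ_{B b}Ψ′_c`. [folklore] -/
theorem coupling_window_step (n : ℕ) (a a' : ℝ) {ε γ μ ν ν' CΨ CG CN νN : ℝ} (hε : 0 ≤ ε) (hγ : 0 < γ) (hν' : 0 < ν')
    (hν'ν : ν' < ν) (hνμ : ν < μ) (hνN : 0 < νN)
    (V : X d → ℝ) (K : X d → X d → ℝ) (hK : ∀ p q, |K p q| ≤ ε * exp (-(γ * ∑ i, (((p i - q i).natAbs : ℕ) : ℝ))))
    -- (P1) the columns at `a`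
    (Ψ : X d → X d → ℝ) (hΨd : ∀ c p, |Ψ c p| ≤ CΨ * exp (-(μ * ∑ i, (((blk n p i - c i).natAbs : ℕ) : ℝ))))
    (hΨ : ∀ c p, ((n : ℝ) + 1) ^ 2 * ∑ μ', (2 * Ψ c p - Ψ c (p + e μ') - Ψ c (p - e μ'))
        + a / ((n : ℝ) + 1) ^ d * ∑ q ∈ B n (blk n p), Ψ c q + V p * Ψ c p + ∑' q : X d, K p q * Ψ c q
          = if blk n p = c then 1 else 0)
    -- (P2) the solution operator at `a`
    (G : lp (fun _ : X d => ℝ) ∞ →L[ℝ] lp (fun _ : X d => ℝ) ∞) (hGn : ‖G‖ ≤ CG)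
    (hG : ∀ (f : lp (fun _ : X d => ℝ) ∞) (p : X d),
      ((n : ℝ) + 1) ^ 2 * ∑ μ', (2 * G f p - G f (p + e μ') - G f (p - e μ'))
        + a / ((n : ℝ) + 1) ^ d * ∑ q ∈ B n (blk n p), G f q + V p * G f p + ∑' q : X d, K p q * G f q = f p)
    -- (P3) uniqueness of bounded solutions at `a`
    (hU : ∀ (f : X d → ℝ) (Mf : ℝ), (∀ p, |f p| ≤ Mf) → ∀ (u v : X d → ℝ) (Bu Bv : ℝ), (∀ p, |u p| ≤ Bu) → (∀ p, |v p| ≤ Bv) →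
        (∀ p, ((n : ℝ) + 1) ^ 2 * ∑ μ', (2 * u p - u (p + e μ') - u (p - e μ'))
          + a / ((n : ℝ) + 1) ^ d * ∑ q ∈ B n (blk n p), u q + V p * u p + ∑' q : X d, K p q * u q = f p) →
        (∀ p, ((n : ℝ) + 1) ^ 2 * ∑ μ', (2 * v p - v (p + e μ') - v (p - e μ'))
          + a / ((n : ℝ) + 1) ^ d * ∑ q ∈ B n (blk n p), v q + V p * v p + ∑' q : X d, K p q * v q = f p) →
        ∀ p, u p = v p)
    -- (P4) the two-sided decaying inverse of the coarse matrix at `a`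
    (N : X d → X d → ℝ) (hNd : ∀ b c, |N b c| ≤ CN * exp (-(νN * ∑ i, (((b i - c i).natAbs : ℕ) : ℝ))))
    (hTN : ∀ b c', ∑' c : X d, ((((n : ℝ) + 1) ^ d)⁻¹ * ∑ q ∈ B n b, Ψ c q) * N c c' = if b = c' then 1 else 0)
    (hNT : ∀ c b, ∑' b' : X d, N c b' * ((((n : ℝ) + 1) ^ d)⁻¹ * ∑ q ∈ B n b', Ψ b q) = if c = b then 1 else 0)
    -- the two thresholds
    (hs1 : (exp (ν * d) * (2 * (1 - exp (-1))⁻¹) ^ d)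
      * (|a' - a| * CΨ * exp (ν * d) * (2 * (1 - exp (-(μ - ν)))⁻¹) ^ d) ≤ 1 / 2)
    (hs2 : |a' - a| * CG ≤ 1 / 2) :
    ∃ (Ψ' : X d → X d → ℝ) (G' : lp (fun _ : X d => ℝ) ∞ →L[ℝ] lp (fun _ : X d => ℝ) ∞),
      -- (P1′)
      (∀ c p, |Ψ' c p| ≤ 2 * (exp (ν * d) * (2 * (1 - exp (-1))⁻¹) ^ d) * CΨ * (2 * (1 - exp (-(μ - ν)))⁻¹) ^ d
        * exp (-(ν * ∑ i, (((blk n p i - c i).natAbs : ℕ) : ℝ)))) ∧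
      (∀ c p, ((n : ℝ) + 1) ^ 2 * ∑ μ', (2 * Ψ' c p - Ψ' c (p + e μ') - Ψ' c (p - e μ'))
        + a' / ((n : ℝ) + 1) ^ d * ∑ q ∈ B n (blk n p), Ψ' c q + V p * Ψ' c p + ∑' q : X d, K p q * Ψ' c q
          = if blk n p = c then 1 else 0) ∧
      -- (P2′)
      (∀ f : lp (fun _ : X d => ℝ) ∞, ‖G' f‖ ≤ 2 * CG * ‖f‖) ∧
      (∀ (f : lp (fun _ : X d => ℝ) ∞) (p : X d),
        ((n : ℝ) + 1) ^ 2 * ∑ μ', (2 * G' f p - G' f (p + e μ') - G' f (p - e μ'))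
          + a' / ((n : ℝ) + 1) ^ d * ∑ q ∈ B n (blk n p), G' f q + V p * G' f p + ∑' q : X d, K p q * G' f q = f p) ∧
      -- (P3′)
      (∀ (f : X d → ℝ) (Mf : ℝ), (∀ p, |f p| ≤ Mf) → ∀ (u v : X d → ℝ) (Bu Bv : ℝ), (∀ p, |u p| ≤ Bu) → (∀ p, |v p| ≤ Bv) →
        (∀ p, ((n : ℝ) + 1) ^ 2 * ∑ μ', (2 * u p - u (p + e μ') - u (p - e μ'))
          + a' / ((n : ℝ) + 1) ^ d * ∑ q ∈ B n (blk n p), u q + V p * u p + ∑' q : X d, K p q * u q = f p) →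
        (∀ p, ((n : ℝ) + 1) ^ 2 * ∑ μ', (2 * v p - v (p + e μ') - v (p - e μ'))
          + a' / ((n : ℝ) + 1) ^ d * ∑ q ∈ B n (blk n p), v q + V p * v p + ∑' q : X d, K p q * v q = f p) →
        ∀ p, u p = v p) ∧
      -- (P4′) right and left inverse `N + (a′−a)·1`
      (∀ b c', Summable (fun c : X d => ((((n : ℝ) + 1) ^ d)⁻¹ * ∑ q ∈ B n b, Ψ' c q) * (N c c' + (a' - a) * (if c = c' then 1 else 0))) ∧
        ∑' c : X d, ((((n : ℝ) + 1) ^ d)⁻¹ * ∑ q ∈ B n b, Ψ' c q) * (N c c' + (a' - a) * (if c = c' then 1 else 0))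
          = if b = c' then 1 else 0) ∧
      (∀ c b, Summable (fun b' : X d => (N c b' + (a' - a) * (if c = b' then 1 else 0))
          * ((((n : ℝ) + 1) ^ d)⁻¹ * ∑ q ∈ B n b', Ψ' b q)) ∧
        ∑' b' : X d, (N c b' + (a' - a) * (if c = b' then 1 else 0)) * ((((n : ℝ) + 1) ^ d)⁻¹ * ∑ q ∈ B n b', Ψ' b q)
          = if c = b then 1 else 0) := by
  classical
  have hν : 0 < ν := hν'.trans hν'ν
  have hS0 : ∀ b c : X d, (0 : ℝ) ≤ ∑ i, (((b i - c i).natAbs : ℕ) : ℝ) := fun _ _ => by positivity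
  have hCΨ : 0 ≤ CΨ := by
    have h := (abs_nonneg _).trans (hΨd 0 0); exact le_of_mul_le_mul_right (by rw [zero_mul]; exact h) (exp_pos _)
  -- (P1′): the transferred columns ((262))
  obtain ⟨R, Ψ', hRd, hRright, -, -, hΨ'd, hΨ', hmean⟩ :=
    transferred_columns n a a' hε hγ hν hνμ V K hK Ψ hΨd hΨ hs1
  -- (P2′): the transferred solution operator ((263))
  obtain ⟨G', hG'n, hG'⟩ := solution_operator_transfer n a a' V K G hGn hG hs2
  -- (P3′): uniqueness at `a′` ((261) with (E) at `a` from `G`)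
  have hE := solvability_of_clm n a V K G hGn hG
  have hs2' : |a' - a| * CG < 1 := lt_of_le_of_lt hs2 (by norm_num)
  have hU' := uniqueness_transfer n a a' hγ V K hK hE hU hs2'
  refine ⟨Ψ', G', hΨ'd, hΨ', hG'n, hG', hU', fun b c' => ?_, fun c b => ?_⟩
  · -- right inverse ((259)), with both column families read at the rate `ν` and the coarse rate `ν′`
    have hΨdν : ∀ c p, |Ψ c p| ≤ CΨ * exp (-(ν * ∑ i, (((blk n p i - c i).natAbs : ℕ) : ℝ))) := fun c p =>
      (hΨd c p).trans (mul_le_mul_of_nonneg_left (exp_le_exp.2 (neg_le_neg (mul_le_mul_of_nonneg_right hνμ.le (hS0 _ _)))) hCΨ)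
    exact coupling_shift_right_inverse n a a' hε hγ hν' hν'ν hνN V K hK Ψ hΨdν hΨ Ψ' hΨ'd hΨ' hU' N hNd hTN b c'
  · -- left inverse ((262) §3), read through the coarse matrix of `Ψ′`
    have h := transferred_left_inverse n a a' hν hνμ hνN Ψ hΨd R hRd (fun b₁ c₁ => (hRright b₁ c₁).2) N hNd hNT c b
    simp only [← hmean] at h
    exact h

/-! ## §2. Toy -/

/-- Toy (`d = 1`): both thresholds of the window step hold trivially at `a′ = a` (a step of length zero), whatever the reference
constants. -/
example (a CΨ CG ν μ : ℝ) :
    (exp (ν * (1 : ℕ)) * (2 * (1 - exp (-1))⁻¹) ^ 1) * (|a - a| * CΨ * exp (ν * (1 : ℕ)) * (2 * (1 - exp (-(μ - ν)))⁻¹) ^ 1) ≤ 1 / 2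
      ∧ |a - a| * CG ≤ 1 / 2 := by
  rw [sub_self, abs_zero, zero_mul, zero_mul, zero_mul, mul_zero, zero_mul]
  norm_num

end Summit.QuantumFields.BalabanUV.T4Continuum.NE7b.SupZdCouplingWindowStep
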